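import Mathlib.MeasureTheory.Integral.DominatedConvergence
import Mathlib.Analysis.Normed.Group.InfiniteSum
import Literature.Probability.Exchangeability.BlockAverages
import HarnessLib

/-!
# The limit statistic of an exchangeable sequence and the directing kernel

For `f : E → ℝ` bounded measurable we define the **limit statistic**
`limAvg f x := limsup_m blockAvg (range (4^m)) f x`, a measurable function of `x : ℕ → E` which
is EXACTLY invariant under finitely supported permutations of the coordinates, hence measurable
for the exchangeable σ-algebra `ℰ`.  Under an exchangeable probability law `P`:

* `IsExchangeable.ae_tendsto_blockAvg` — the block averages over the first `4^m` coordinates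
  converge a.s. to `limAvg f` (the `L²` increments are summable: `BlockAverages.lean`);
* `IsExchangeable.setIntegral_limAvg_eq`, `limAvg_ae_eq_condExp` — `limAvg f = P[f (x 0) | ℰ]`
  a.s.;
* `directingKernel P` — the **directing random measure** `ν_x = P[x 0 ∈ · | ℰ](x)`, a Markov
  kernel `(ℕ → E) → E` (a version of the conditional law of the first coordinate given `ℰ`,
  built from Mathlib's `condExpKernel`; needs `E` standard Borel), with
  `limAvg f = ∫ f dν_x` a.s. (`limAvg_ae_eq_integral_directingKernel`).

This is the analytic core of the proof of de Finetti's theorem (`DeFinetti.lean`): Kallenberg's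
`η = P[ξ₁ ∈ · | 𝓘_ξ]` with the invariant σ-field replaced by the exchangeable one.

## References

* O. Kallenberg, *Foundations of Modern Probability*, 2nd ed. (2002), Thm 11.10 and its proof.
  [Kallenberg2002]
-/

namespace Literature.Probability.Exchangeability

open _root_.MeasureTheory _root_.ProbabilityTheory Equiv Function Set Finset Filter
open scoped Topology ENNReal

variable {E : Type*}

/-- `m ≤ 4^m`. [folklore] -/
theorem le_four_pow (m : ℕ) : m ≤ 4 ^ m := (Nat.lt_pow_self (by norm_num)).le

/-- The limit statistic is EXACTLY invariant under permutations of finitely many coordinates.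
[folklore] -/
theorem limAvg_comp_perm_eq {σ : Perm ℕ} {N : ℕ} (hσ : ∀ n, N ≤ n → σ n = n) (f : E → ℝ)
    (x : ℕ → E) : limAvg f (x ∘ σ) = limAvg f x := by
  unfold limAvg
  refine limsup_congr ?_
  filter_upwards [eventually_ge_atTop N] with m hm
  exact blockAvg_range_comp_perm (fun n hn => hσ n (hm.trans ((le_four_pow m).trans hn))) f x

/-- In particular the limit statistic is invariant under transposing two coordinates.
[folklore] -/
theorem limAvg_comp_swap (f : E → ℝ) (i j : ℕ) (x : ℕ → E) :
    limAvg f (x ∘ swap i j) = limAvg f x :=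
  limAvg_comp_perm_eq (N := max i j + 1)
    (fun n hn => swap_apply_of_ne_of_ne (by omega) (by omega)) f x

variable [MeasurableSpace E]

/-- The limit statistic is measurable for the EXCHANGEABLE σ-algebra. [folklore] -/
theorem measurable_exchangeableSigmaAlgebra_limAvg {f : E → ℝ} (hf : Measurable f) :
    Measurable[exchangeableSigmaAlgebra E] (limAvg f) :=
  measurable_exchangeableSigmaAlgebra_of_invariant (measurable_limAvg hf)
    fun i j x => limAvg_comp_swap f i j x

/-- Elementary `L¹`–`L²` trade-off used in place of Cauchy–Schwarz: `|y| ≤ t/2 + y²/(2t)` for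
`t > 0`. [folklore] -/
theorem abs_le_half_add_sq_div {y t : ℝ} (ht : 0 < t) : |y| ≤ t / 2 + y ^ 2 / (2 * t) := by
  have h := two_mul_le_add_sq t |y|
  rw [sq_abs] at h
  rw [div_add_div _ _ (two_ne_zero) (by positivity), le_div_iff₀ (by positivity)]
  nlinarith [abs_nonneg y]

namespace IsExchangeable

variable {P : Measure (ℕ → E)} [IsProbabilityMeasure P]

/-- `L¹` increments of the dyadic(`4^m`) block averages are geometrically small:
`∫ |u_{m+1} - u_m| dP ≤ (1/2 + M²) 2⁻ᵐ`. [folklore] -/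
theorem integral_abs_blockAvg_succ_sub_le (h : IsExchangeable P) {f : E → ℝ} (hf : Measurable f)
    {M : ℝ} (hM : ∀ z, |f z| ≤ M) (m : ℕ) :
    ∫ x, |blockAvg (Finset.range (4 ^ (m + 1))) f x - blockAvg (Finset.range (4 ^ m)) f x| ∂P
      ≤ (1 / 2 + M ^ 2) * (2⁻¹ : ℝ) ^ m := by
  obtain ⟨x₀⟩ := nonempty_of_isProbabilityMeasure P
  have hM0 : 0 ≤ M := (abs_nonneg _).trans (hM (x₀ 0))
  set s := Finset.range (4 ^ m) with hs
  set t := Finset.range (4 ^ (m + 1)) with ht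
  have hst : s ⊆ t := Finset.range_subset_range.mpr (Nat.pow_le_pow_right (by norm_num) (by omega))
  have hsn : s.Nonempty := Finset.nonempty_range_iff.mpr (by positivity)
  have hsq : ∫ x, (blockAvg s f x - blockAvg t f x) ^ 2 ∂P ≤ 2 * M ^ 2 * ((4 : ℝ) ^ m)⁻¹ := by
    have := h.integral_blockAvg_sub_sq_le hf hM hst hsn
    simpa [hs] using this
  have hτ : (0 : ℝ) < (2⁻¹ : ℝ) ^ m := by positivity
  have hmeas : Measurable fun x => blockAvg t f x - blockAvg s f x :=
    (measurable_blockAvg t hf).sub (measurable_blockAvg s hf)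
  have hbd : ∀ x, |blockAvg t f x - blockAvg s f x| ≤ 2 * M := fun x =>
    (abs_sub _ _).trans (by linarith [abs_blockAvg_le hM hM0 t x, abs_blockAvg_le hM hM0 s x])
  have hint_sq : Integrable (fun x => (blockAvg t f x - blockAvg s f x) ^ 2) P := by
    refine integrable_of_abs_le (hmeas.pow_const 2) (M := (2 * M) ^ 2) fun x => ?_
    rw [abs_pow]
    exact pow_le_pow_left₀ (abs_nonneg _) (hbd x) 2
  calc ∫ x, |blockAvg t f x - blockAvg s f x| ∂P
      ≤ ∫ x, (2⁻¹ : ℝ) ^ m / 2 + (blockAvg t f x - blockAvg s f x) ^ 2 / (2 * (2⁻¹ : ℝ) ^ m) ∂P := by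
        refine integral_mono_of_nonneg (Eventually.of_forall fun _ => abs_nonneg _)
          ((integrable_const _).add (hint_sq.div_const _)) (Eventually.of_forall fun x => ?_)
        exact abs_le_half_add_sq_div hτ
    _ = (2⁻¹ : ℝ) ^ m / 2 + (∫ x, (blockAvg t f x - blockAvg s f x) ^ 2 ∂P) / (2 * (2⁻¹ : ℝ) ^ m) := by
        rw [integral_add (integrable_const _) (hint_sq.div_const _), integral_const,
          integral_div]
        simp
    _ ≤ (2⁻¹ : ℝ) ^ m / 2 + (2 * M ^ 2 * ((4 : ℝ) ^ m)⁻¹) / (2 * (2⁻¹ : ℝ) ^ m) := by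
        gcongr
        calc ∫ x, (blockAvg t f x - blockAvg s f x) ^ 2 ∂P
            = ∫ x, (blockAvg s f x - blockAvg t f x) ^ 2 ∂P := by
              congr 1 with x; ring
          _ ≤ _ := hsq
    _ = (1 / 2 + M ^ 2) * (2⁻¹ : ℝ) ^ m := by
        have h4 : ((4 : ℝ) ^ m)⁻¹ = (2⁻¹ : ℝ) ^ m * (2⁻¹ : ℝ) ^ m := by
          rw [← mul_pow, ← inv_pow]; norm_num
        rw [h4]
        field_simp

/-- **A.s. convergence of the block averages** over the first `4^m` coordinates to the limit
statistic, under an exchangeable law (the `L¹` increments are summable).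
[cite: Kallenberg2002, Thm 11.10 (proof)] -/
theorem ae_tendsto_blockAvg (h : IsExchangeable P) {f : E → ℝ} (hf : Measurable f) {M : ℝ}
    (hM : ∀ z, |f z| ≤ M) :
    ∀ᵐ x ∂P, Tendsto (fun m => blockAvg (Finset.range (4 ^ m)) f x) atTop (𝓝 (limAvg f x)) := by
  set u : ℕ → (ℕ → E) → ℝ := fun m x => blockAvg (Finset.range (4 ^ m)) f x with hu
  have hmeasD : ∀ m, Measurable fun x => u (m + 1) x - u m x := fun m =>
    (measurable_blockAvg _ hf).sub (measurable_blockAvg _ hf)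
  obtain ⟨x₀⟩ := nonempty_of_isProbabilityMeasure P
  have hM0 : 0 ≤ M := (abs_nonneg _).trans (hM (x₀ 0))
  have hintD : ∀ m, Integrable (fun x => u (m + 1) x - u m x) P := fun m =>
    integrable_of_abs_le (hmeasD m) (M := 2 * M) fun x => (abs_sub _ _).trans
      (by linarith [abs_blockAvg_le hM hM0 (Finset.range (4 ^ (m + 1))) x,
        abs_blockAvg_le hM hM0 (Finset.range (4 ^ m)) x])
  have hle : ∀ m, ∫⁻ x, ‖u (m + 1) x - u m x‖ₑ ∂P ≤
      ENNReal.ofReal ((1 / 2 + M ^ 2) * (2⁻¹ : ℝ) ^ m) := by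
    intro m
    rw [← ofReal_integral_norm_eq_lintegral_enorm (hintD m)]
    apply ENNReal.ofReal_le_ofReal
    simpa only [Real.norm_eq_abs] using h.integral_abs_blockAvg_succ_sub_le hf hM m
  have hgeom : Summable fun m : ℕ => (1 / 2 + M ^ 2) * (2⁻¹ : ℝ) ^ m :=
    (summable_geometric_of_lt_one (by norm_num) (by norm_num)).mul_left _
  have hlin : ∫⁻ x, ∑' m, ‖u (m + 1) x - u m x‖ₑ ∂P ≠ ∞ := by
    rw [lintegral_tsum (fun m => (hmeasD m).enorm.aemeasurable)]
    refine ne_top_of_le_ne_top ?_ (ENNReal.tsum_le_tsum hle)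
    rw [← ENNReal.ofReal_tsum_of_nonneg (fun m => by positivity) hgeom]
    exact ENNReal.ofReal_ne_top
  have hae : ∀ᵐ x ∂P, ∑' m, ‖u (m + 1) x - u m x‖ₑ < ∞ :=
    ae_lt_top' (AEMeasurable.tsum fun m => (hmeasD m).enorm.aemeasurable) hlin
  filter_upwards [hae] with x hx
  have hsum : Summable (fun m => u (m + 1) x - u m x) := by
    refine Summable.of_nnnorm (ENNReal.tsum_coe_ne_top_iff_summable.mp ?_)
    simpa only [enorm_eq_nnnorm] using hx.ne
  have h2 : ∀ n, u n x = u 0 x + ∑ i ∈ Finset.range n, (u (i + 1) x - u i x) := by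
    intro n
    have := Finset.sum_range_sub (fun i => u i x) n
    linarith
  have htend : Tendsto (fun m => u m x) atTop (𝓝 (u 0 x + ∑' m, (u (m + 1) x - u m x))) := by
    have := hsum.hasSum.tendsto_sum_nat
    rw [show (fun m => u m x) = fun m => u 0 x + ∑ i ∈ Finset.range m, (u (i + 1) x - u i x)
      from funext h2]
    exact tendsto_const_nhds.add this
  have hlim : limAvg f x = u 0 x + ∑' m, (u (m + 1) x - u m x) := htend.limsup_eq
  rw [hlim]
  exact htend

/-- The limit statistic of an `f` with `|f| ≤ M` is a.s. bounded by `M`. [folklore] -/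
theorem ae_abs_limAvg_le (h : IsExchangeable P) {f : E → ℝ} (hf : Measurable f) {M : ℝ}
    (hM : ∀ z, |f z| ≤ M) : ∀ᵐ x ∂P, |limAvg f x| ≤ M := by
  obtain ⟨x₀⟩ := nonempty_of_isProbabilityMeasure P
  have hM0 : 0 ≤ M := (abs_nonneg _).trans (hM (x₀ 0))
  filter_upwards [h.ae_tendsto_blockAvg hf hM] with x hx
  exact le_of_tendsto' hx.abs fun m => abs_blockAvg_le hM hM0 _ _

/-- The limit statistic of a bounded measurable `f` is integrable. [folklore] -/
theorem integrable_limAvg (h : IsExchangeable P) {f : E → ℝ} (hf : Measurable f) {M : ℝ}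
    (hM : ∀ z, |f z| ≤ M) : Integrable (limAvg f) P :=
  (integrable_const M).mono' (measurable_limAvg hf).aestronglyMeasurable
    (by filter_upwards [h.ae_abs_limAvg_le hf hM] with x hx; simpa [Real.norm_eq_abs] using hx)

/-- **`L¹` convergence** of the block averages over the first `4^m` coordinates to the limit
statistic. [folklore] -/
theorem tendsto_integral_abs_blockAvg_sub_limAvg (h : IsExchangeable P) {f : E → ℝ}
    (hf : Measurable f) {M : ℝ} (hM : ∀ z, |f z| ≤ M) :
    Tendsto (fun m => ∫ x, |blockAvg (Finset.range (4 ^ m)) f x - limAvg f x| ∂P)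
      atTop (𝓝 0) := by
  obtain ⟨x₀⟩ := nonempty_of_isProbabilityMeasure P
  have hM0 : 0 ≤ M := (abs_nonneg _).trans (hM (x₀ 0))
  have := tendsto_integral_of_dominated_convergence (μ := P) (fun _ => 2 * M)
    (F := fun m x => |blockAvg (Finset.range (4 ^ m)) f x - limAvg f x|) (f := fun _ => 0)
    (fun m => ((measurable_blockAvg (Finset.range (4 ^ m)) hf).sub
      (measurable_limAvg hf)).norm.aestronglyMeasurable)
    (integrable_const _) ?_ ?_
  · simpa using this
  · intro m
    filter_upwards [h.ae_abs_limAvg_le hf hM] with x hx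
    rw [Real.norm_eq_abs, abs_abs]
    exact (abs_sub _ _).trans (by linarith [abs_blockAvg_le hM hM0 (Finset.range (4 ^ m)) x])
  · filter_upwards [h.ae_tendsto_blockAvg hf hM] with x hx
    have := (hx.sub_const (limAvg f x)).abs
    simpa using this

/-- Over an event of the exchangeable σ-algebra, block averages over an initial segment integrate
like `f (x 0)`: `∫_A blockAvg (range N) f dP = ∫_A f (x 0) dP`. [folklore] -/
theorem setIntegral_blockAvg_range_eq (h : IsExchangeable P) {f : E → ℝ} (hf : Measurable f)
    {M : ℝ} (hM : ∀ z, |f z| ≤ M) {A : Set (ℕ → E)}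
    (hA : MeasurableSet[exchangeableSigmaAlgebra E] A) {N : ℕ} (hN : 0 < N) :
    ∫ x in A, blockAvg (Finset.range N) f x ∂P = ∫ x in A, f (x 0) ∂P := by
  have hint : ∀ i : ℕ, Integrable (fun x : ℕ → E => f (x i)) (P.restrict A) := fun i =>
    (integrable_of_abs_le (hf.comp (measurable_pi_apply i)) (fun x => hM (x i))).restrict
  simp only [blockAvg_def]
  rw [integral_const_mul, integral_finsetSum _ (fun i _ => hint i),
    Finset.sum_congr rfl fun i _ => h.setIntegral_eval_eq hA f i, Finset.sum_const,
    Finset.card_range, nsmul_eq_mul]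
  have hN' : (N : ℝ) ≠ 0 := by exact_mod_cast hN.ne'
  field_simp

/-- **The limit statistic is a version of `E[f (x 0) | ℰ]`**, set-integral form:
`∫_A limAvg f dP = ∫_A f (x 0) dP` for every `A ∈ ℰ`. [cite: Kallenberg2002, Thm 11.10 (proof)] -/
theorem setIntegral_limAvg_eq (h : IsExchangeable P) {f : E → ℝ} (hf : Measurable f) {M : ℝ}
    (hM : ∀ z, |f z| ≤ M) {A : Set (ℕ → E)} (hA : MeasurableSet[exchangeableSigmaAlgebra E] A) :
    ∫ x in A, limAvg f x ∂P = ∫ x in A, f (x 0) ∂P := by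
  obtain ⟨x₀⟩ := nonempty_of_isProbabilityMeasure P
  have hM0 : 0 ≤ M := (abs_nonneg _).trans (hM (x₀ 0))
  have htend : Tendsto (fun m => ∫ x in A, blockAvg (Finset.range (4 ^ m)) f x ∂P) atTop
      (𝓝 (∫ x in A, limAvg f x ∂P)) :=
    tendsto_integral_of_dominated_convergence (fun _ => M)
      (fun m => (measurable_blockAvg _ hf).aestronglyMeasurable) (integrable_const M)
      (fun m => Eventually.of_forall fun x => by
        simpa [Real.norm_eq_abs] using abs_blockAvg_le hM hM0 (Finset.range (4 ^ m)) x)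
      (ae_restrict_of_ae (h.ae_tendsto_blockAvg hf hM))
  have hconst : ∀ m, ∫ x in A, blockAvg (Finset.range (4 ^ m)) f x ∂P = ∫ x in A, f (x 0) ∂P :=
    fun m => h.setIntegral_blockAvg_range_eq hf hM hA (by positivity)
  simp_rw [hconst] at htend
  exact (tendsto_const_nhds_iff.mp htend).symm

/-- **The limit statistic is a version of the conditional expectation `P[f (x 0) | ℰ]`**.
[cite: Kallenberg2002, Thm 11.10 (proof)] -/
theorem limAvg_ae_eq_condExp (h : IsExchangeable P) {f : E → ℝ} (hf : Measurable f) {M : ℝ}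
    (hM : ∀ z, |f z| ≤ M) :
    limAvg f =ᵐ[P] P[fun x : ℕ → E => f (x 0) | exchangeableSigmaAlgebra E] := by
  refine ae_eq_condExp_of_forall_setIntegral_eq exchangeableSigmaAlgebra_le
    (integrable_of_abs_le (hf.comp (measurable_pi_apply 0)) (fun x => hM (x 0)))
    (fun s _ _ => (h.integrable_limAvg hf hM).integrableOn)
    (fun s hs _ => h.setIntegral_limAvg_eq hf hM hs) ?_
  exact (measurable_exchangeableSigmaAlgebra_limAvg hf).aestronglyMeasurable

end IsExchangeable

/-! ### The directing kernel integrates the limit statistic -/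

section Directing

variable [StandardBorelSpace E] {P : Measure (ℕ → E)} [IsProbabilityMeasure P]

/-- **The limit statistic is the `ν`-integral**: `limAvg f (x) = ∫ f dν_x` for `P`-a.e. `x`,
for every bounded measurable `f`. [cite: Kallenberg2002, Thm 11.10 (proof)] -/
theorem IsExchangeable.limAvg_ae_eq_integral_directingKernel (h : IsExchangeable P) {f : E → ℝ}
    (hf : Measurable f) {M : ℝ} (hM : ∀ z, |f z| ≤ M) :
    limAvg f =ᵐ[P] fun x => ∫ z, f z ∂(directingKernel P x) := by
  have h1 := h.limAvg_ae_eq_condExp hf hM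
  have hint : Integrable (fun x : ℕ → E => f (x 0)) P :=
    integrable_of_abs_le (hf.comp (measurable_pi_apply 0)) (fun x => hM (x 0))
  have h2 := condExp_ae_eq_integral_condExpKernel (μ := P) exchangeableSigmaAlgebra_le hint
  refine h1.trans (h2.trans (Eventually.of_forall fun x => ?_))
  simp only [integral_directingKernel P x hf]

/-- Set form: `ν_x(B) = limAvg 𝟙_B (x)` for `P`-a.e. `x`. [cite: Kallenberg2002, Thm 11.10 (proof)] -/
theorem IsExchangeable.directingKernel_real_ae_eq_limAvg (h : IsExchangeable P) {B : Set E}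
    (hB : MeasurableSet B) :
    (fun x => (directingKernel P x).real B) =ᵐ[P] limAvg (B.indicator 1) := by
  have hbd : ∀ z : E, |B.indicator (1 : E → ℝ) z| ≤ 1 := fun z => by
    by_cases hz : z ∈ B <;> simp [hz]
  filter_upwards [h.limAvg_ae_eq_integral_directingKernel (measurable_one.indicator hB) hbd]
    with x hx
  rw [hx, integral_indicator_one hB]

end Directing

end Literature.Probability.Exchangeability
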